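import Summits.QuantumAdvantage.AdviceFreeQNC0.WalkTubeRank
import Summits.QuantumAdvantage.AdviceFreeQNC0.WalkTubeWalk
import Summits.QuantumAdvantage.AdviceFreeQNC0.BinomialTailLower
import Summits.QuantumAdvantage.AdviceFreeQNC0.WalkSupportLemma
import Summits.QuantumAdvantage.QuantumAdvantage.Theses.RingFrame
import HarnessLib

/-!
# Route `RingFrame`, crux α: `RingToElim` — PROVED (the tube bound; self-contained assembly)

Cell qa-qnc0 (rung F-Q1).  The crux item stmt-QuantumAdvantage-19119
`Summit.QuantumAdvantage.QuantumAdvantage.Theses.RingFrame.RingToElim` (`ElimHard → RingHard 2`) is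
closed by proving its conclusion `RingHard 2` through planner qa-qnc0-p2's ROUND-11 chain, all of whose
links are kernel theorems of the cell topic `Summits/QuantumAdvantage/AdviceFreeQNC0/`:
`tubeBound : TubeBound` and `tubePlan : TubePlan` (`WalkTubeRank.lean`), `binomTailLower :
BinomTailLower` (`BinomialTailLower.lean`), and the tube mass T11-4, whose B4 assembly is carried out
INSIDE the proof below over the walk lemmas of `WalkTubeWalk.lean` (B1 `pdist_aPat_eq`, B2
`chebyshev_count`, B3 `reflection_count`); the landed `WalkTubeMass.tubeMass` proves the same `TubeMass`
as a named theorem (this file does not import it).  Then `WalkHardAll`, the Sketch11 tail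
(`WalkTransport.ringHard_two_of_walkHard`), `RingHard 2`, `RingToElim`.
-/

-- the sub-problem namespace `Summit.QuantumAdvantage.QuantumAdvantage` repeats the summit name by design (D-0017)
set_option linter.dupNamespace false

noncomputable section

open Classical

namespace Summit.QuantumAdvantage.QuantumAdvantage.Theorems

open Finset
open Summit.QuantumAdvantage.AdviceFreeQNC0 Summit.QuantumAdvantage.AdviceFreeQNC0.TubeMassProof
open Literature.Computability.MetaComplexity Literature.Computability.MetaComplexity.Smolensky

/-- **Crux α `RingToElim` — PROVED** (stmt-QuantumAdvantage-19119), self-contained assembly: the tube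
mass `TubeMass` (C = 6, m₀ = 256) is derived inside the proof from the reflection principle and
Chebyshev (`WalkTubeWalk.lean`), then `tubePlan tubeBound _ binomTailLower : WalkHardAll`, then the
ring transport. -/
theorem ringToElim_tube : Summit.QuantumAdvantage.QuantumAdvantage.Theses.RingFrame.RingToElim := by
  -- ### T11-4 inside: the tube mass
  have hmass : TubeMass := by
    -- counting through conjugation
    have card_filter_conj : ∀ (m : ℕ) (P : (Fin m → Bool) → Prop),
        (univ.filter fun a : Fin m → Bool => P (conj a)).card = (univ.filter P).card := by
      intro m P
      refine card_bij (fun a _ => conj a) (fun a ha => ?_) (fun a _ b _ h => ?_) (fun b hb => ?_)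
      · rw [mem_filter] at ha ⊢; exact ⟨mem_univ _, ha.2⟩
      · have := congrArg conj h; rwa [conj_conj, conj_conj] at this
      · refine ⟨conj b, ?_, conj_conj b⟩
        rw [mem_filter] at hb ⊢; exact ⟨mem_univ _, by rw [conj_conj]; exact hb.2⟩
    -- near the path ⇒ LOW: some cut with `2S_g − S_m ≤ −W`, `W = m − 2k`
    have lowEv_of_nearPath : ∀ (m k : ℕ), 2 * k ≤ m → ∀ a : Fin m → Bool, NearPath k a →
        ∃ g : ℕ, g ≤ m ∧ 2 * S a g - S a m ≤ -((m - 2 * k : ℕ) : ℤ) := by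
      intro m k hk a h
      obtain ⟨g, hgm, hg⟩ := (nearPath_iff k a).1 h
      refine ⟨g, hgm, ?_⟩
      have h1 := pdist_aPat_eq a g
      have h2 := two_wtP_add_S a
      have h3 : (pdist a (aPat g) : ℤ) ≤ k := by exact_mod_cast hg
      have h4 : ((m - 2 * k : ℕ) : ℤ) = (m : ℤ) - 2 * k := by
        rw [Nat.cast_sub hk]; push_cast; ring
      rw [h4]
      linarith
    have lowEv_conj : ∀ (m k : ℕ), 2 * k ≤ m → ∀ a : Fin m → Bool, NearPath k (conj a) →
        ∃ g : ℕ, g ≤ m ∧ 2 * S (conj a) g - S (conj a) m ≤ -((m - 2 * k : ℕ) : ℤ) := by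
      intro m k hk a h
      obtain ⟨g, hgm, hg⟩ := (nearPath_iff k (conj a)).1 h
      refine ⟨g, hgm, ?_⟩
      rw [S_conj, S_conj]
      have h0 := pdist_conj_aPat a g
      have h1 := pdist_aPat_eq a g
      have h2 := two_wtP_add_S a
      have h3 : (pdist (conj a) (aPat g) : ℤ) + pdist a (aPat g) = m := by exact_mod_cast h0
      have h3' : (pdist (conj a) (aPat g) : ℤ) ≤ k := by exact_mod_cast hg
      have h4 : ((m - 2 * k : ℕ) : ℤ) = (m : ℤ) - 2 * k := by
        rw [Nat.cast_sub hk]; push_cast; ring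
      rw [h4]
      linarith
    -- LOW ⇒ dip to `−L` or end `≥ L` (`3L ≤ W`)
    have low_cases : ∀ (m W L : ℕ), 3 * L ≤ W → ∀ a : Fin m → Bool,
        (∃ g : ℕ, g ≤ m ∧ 2 * S a g - S a m ≤ -(W : ℤ)) → Hits (L : ℤ) (conj a) ∨ (L : ℤ) ≤ S a m := by
      intro m W L hL a h
      obtain ⟨g, hgm, hg⟩ := h
      by_contra hc
      rw [not_or] at hc
      have h1 : ¬ (L : ℤ) ≤ S (conj a) g := fun hh => hc.1 ⟨g, hgm, hh⟩
      rw [S_conj] at h1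
      have h2 := hc.2
      have h3 : (3 * L : ℕ) ≤ (W : ℤ) := by exact_mod_cast hL
      push_cast at h3
      push Not at h1 h2
      linarith
    -- the bad set: `#{a ∉ FAR_k} ≤ 6·#{L ≤ |S_m|}`
    have card_bad_le : ∀ (m k L : ℕ), 2 * k ≤ m → 3 * L ≤ m - 2 * k →
        (univ.filter fun a : Fin m → Bool => NearPath k a ∨ NearPath k (conj a)).card ≤
          6 * (univ.filter fun a : Fin m → Bool => (L : ℤ) ≤ |S a m|).card := by
      intro m k L hk hL
      set W := m - 2 * k with hW
      set Q := (univ.filter fun a : Fin m → Bool => (L : ℤ) ≤ |S a m|).card with hQ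
      set LOW := univ.filter fun a : Fin m → Bool =>
        ∃ g : ℕ, g ≤ m ∧ 2 * S a g - S a m ≤ -(W : ℤ) with hLOW
      have hlow : LOW.card ≤ 3 * Q := by
        have hsub : LOW ⊆ (univ.filter fun a : Fin m → Bool => Hits (L : ℤ) (conj a)) ∪
            (univ.filter fun a : Fin m → Bool => (L : ℤ) ≤ S a m) := by
          intro a ha
          rw [hLOW, mem_filter] at ha
          rw [mem_union, mem_filter, mem_filter]
          rcases low_cases m W L hL a ha.2 with h | h
          · exact Or.inl ⟨mem_univ _, h⟩
          · exact Or.inr ⟨mem_univ _, h⟩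
        have h1 : (univ.filter fun a : Fin m → Bool => Hits (L : ℤ) (conj a)).card ≤ 2 * Q := by
          rw [card_filter_conj m (fun a => Hits (L : ℤ) a)]
          refine le_trans (reflection_count (L : ℤ))
            (Nat.mul_le_mul_left _ (card_le_card fun a ha => ?_))
          rw [mem_filter] at ha ⊢
          exact ⟨mem_univ _, le_trans ha.2 (le_abs_self _)⟩
        have h2 : (univ.filter fun a : Fin m → Bool => (L : ℤ) ≤ S a m).card ≤ Q :=
          card_le_card fun a ha => by
            rw [mem_filter] at ha ⊢; exact ⟨mem_univ _, le_trans ha.2 (le_abs_self _)⟩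
        calc LOW.card
            ≤ ((univ.filter fun a : Fin m → Bool => Hits (L : ℤ) (conj a)) ∪
                (univ.filter fun a : Fin m → Bool => (L : ℤ) ≤ S a m)).card := card_le_card hsub
          _ ≤ _ := card_union_le _ _
          _ ≤ 2 * Q + Q := Nat.add_le_add h1 h2
          _ = 3 * Q := by ring
      have hsub : (univ.filter fun a : Fin m → Bool => NearPath k a ∨ NearPath k (conj a)) ⊆
          LOW ∪ (univ.filter fun a : Fin m → Bool =>
            ∃ g : ℕ, g ≤ m ∧ 2 * S (conj a) g - S (conj a) m ≤ -(W : ℤ)) := by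
        intro a ha
        rw [mem_filter] at ha
        rw [mem_union, hLOW, mem_filter, mem_filter]
        rcases ha.2 with h | h
        · exact Or.inl ⟨mem_univ _, lowEv_of_nearPath m k hk a h⟩
        · exact Or.inr ⟨mem_univ _, lowEv_conj m k hk a h⟩
      calc (univ.filter fun a : Fin m → Bool => NearPath k a ∨ NearPath k (conj a)).card
          ≤ (LOW ∪ (univ.filter fun a : Fin m → Bool =>
              ∃ g : ℕ, g ≤ m ∧ 2 * S (conj a) g - S (conj a) m ≤ -(W : ℤ))).card := card_le_card hsub
        _ ≤ LOW.card + (univ.filter fun a : Fin m → Bool =>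
              ∃ g : ℕ, g ≤ m ∧ 2 * S (conj a) g - S (conj a) m ≤ -(W : ℤ)).card := card_union_le _ _
        _ = 2 * LOW.card := by
            have e : (univ.filter fun a : Fin m → Bool =>
                ∃ g : ℕ, g ≤ m ∧ 2 * S (conj a) g - S (conj a) m ≤ -(W : ℤ)).card = LOW.card := by
              rw [hLOW]
              convert card_filter_conj m (fun a => ∃ g : ℕ, g ≤ m ∧ 2 * S a g - S a m ≤ -(W : ℤ))
                using 3
            rw [e]; ring
        _ ≤ 2 * (3 * Q) := Nat.mul_le_mul_left _ hlow
        _ = 6 * Q := by ring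
    -- the far tube is the complement of the bad set
    have card_farSet_add : ∀ m k : ℕ, (farSet m k).card +
        (univ.filter fun a : Fin m → Bool => NearPath k a ∨ NearPath k (conj a)).card = 2 ^ m := by
      intro m k
      have e : farSet m k =
          univ.filter fun a : Fin m → Bool => ¬ (NearPath k a ∨ NearPath k (conj a)) := by
        unfold farSet
        exact filter_congr fun a _ => by rw [not_or]
      rw [e, add_comm, card_filter_add_card_filter_not, card_univ, Fintype.card_fun,
        Fintype.card_bool, Fintype.card_fin]
    -- parameters `C = 6`, `m₀ = 256`
    refine ⟨6, 256, fun m hm => ?_⟩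
    set s := Nat.sqrt m with hs
    have hs16 : 16 ≤ s := by rw [hs, Nat.le_sqrt]; omega
    have hss : s * s ≤ m := Nat.sqrt_le m
    have hlt : m < (s + 1) * (s + 1) := Nat.lt_succ_sqrt m
    set k := m / 2 - 6 * s with hk
    have h6s : 12 * s ≤ m := by nlinarith
    have hk2 : 2 * k ≤ m := by omega
    have hW : 12 * s ≤ m - 2 * k := by omega
    set L := (m - 2 * k) / 3 with hL
    have hL3 : 3 * L ≤ m - 2 * k := by rw [hL]; omega
    have hL4 : 4 * s ≤ L := by rw [hL]; omega
    have hLm : 12 * m ≤ L ^ 2 := by nlinarith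
    have hbad := card_bad_le m k L hk2 hL3
    have hcheb := chebyshev_count (m := m) L
    set Q := (univ.filter fun a : Fin m → Bool => (L : ℤ) ≤ |S a m|).card with hQ
    have hfar := card_farSet_add m k
    have h1 : (12 * m : ℤ) * Q ≤ (m : ℤ) * 2 ^ m := by
      have : ((12 * m : ℕ) : ℤ) ≤ ((L ^ 2 : ℕ) : ℤ) := by exact_mod_cast hLm
      push_cast at this
      have hQ0 : (0 : ℤ) ≤ Q := by positivity
      nlinarith
    have hm0 : (0 : ℤ) < m := by exact_mod_cast (show 0 < m by omega)
    have h2 : (12 : ℤ) * Q ≤ 2 ^ m := by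
      have : (m : ℤ) * (12 * Q) ≤ (m : ℤ) * 2 ^ m := by linarith
      exact le_of_mul_le_mul_left this hm0
    have h3 : 12 * Q ≤ 2 ^ m := by exact_mod_cast h2
    omega
  -- ### the chain
  have hwalk : WalkHardAll := tubePlan tubeBound hmass binomTailLower
  intro _
  obtain ⟨θ, hθ, hall⟩ := hwalk
  refine ringHard_two_of_walkHard ⟨θ, hθ, fun C => ?_⟩
  obtain ⟨n₀, hn₀⟩ := hall C
  exact ⟨n₀, fun n hn y hy => hn₀ n hn (n + 2) y hy⟩

end Summit.QuantumAdvantage.QuantumAdvantage.Theorems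

end
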